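import Summits.CriticalPhenomena.PercolationContinuityZ3.Theorems.Transplant.PlanarSkeletonFrmFromDefs
import Summits.CriticalPhenomena.PercolationContinuityZ3.Theorems.Transplant.SkelFrmFromBChoiceResidC
import Summits.CriticalPhenomena.PercolationContinuityZ3.Theorems.Transplant.SkelFrmBChoiceResidC
import Summits.CriticalPhenomena.PercolationContinuityZ3.Theorems.Transplant.SkelFrmFromBChoiceDepth2
import Summits.CriticalPhenomena.PercolationContinuityZ3.Theorems.Transplant.SkelFrmBChoiceDepth2
import Summits.CriticalPhenomena.PercolationContinuityZ3.Theorems.Transplant.SkelFrmFromBChoiceDepthYW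
import Summits.CriticalPhenomena.PercolationContinuityZ3.Theorems.Transplant.SkelFrmBChoiceDepthYW
import Summits.CriticalPhenomena.PercolationContinuityZ3.Theorems.Transplant.SkelFrmFromBChoiceWindow3
import Summits.CriticalPhenomena.PercolationContinuityZ3.Theorems.Transplant.SkelFrmBChoiceWindow3
import Summits.CriticalPhenomena.PercolationContinuityZ3.Theorems.Transplant.SkelFrmFromBChoiceRootLanding2
import Summits.CriticalPhenomena.PercolationContinuityZ3.Theorems.Transplant.SkelFrmBChoiceRootLanding2
import Summits.CriticalPhenomena.PercolationContinuityZ3.Theorems.Transplant.SkelFrmFromBChoiceRootRunY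
import Summits.CriticalPhenomena.PercolationContinuityZ3.Theorems.Transplant.SkelFrmBChoiceRootRunY
import Summits.CriticalPhenomena.PercolationContinuityZ3.Theorems.Transplant.SkelFrmFromBChoiceRootPrefix
import Summits.CriticalPhenomena.PercolationContinuityZ3.Theorems.Transplant.SkelFrmBChoiceRootPrefix
import HarnessLib
import Summits.CriticalPhenomena.PercolationContinuityZ3.Theorems.Transplant.SkelFrmBChoiceResidR
/-!
# U-WAVE PORT (RULING D-U, lead g21 2026-08-26; WAVE-U-MANIFEST v3.0 row «SkelFrmBChoiceResidR» ↦ «SkelFrmFromBChoiceResidR») of the tree module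
# `Transplant/SkelFrmBChoiceResidR` onto the carrier `PlanarSkeletonFrmFrom` (frames only, cylinders connected from width `ℓ₀` on)

ORIGINAL TITLE: N2 (frames-only node `SamePDropOfSkeletonFrm₁`, OPEN), (R) column — **THE (R) RESIDUAL SLOT FUNCTIONS OF RECORD** for stmt's parametric unions

builds on p205010 (kernel theorem, internal audit signed; external expert review pending) — nothing in this file uses p205010; NOTHING is claimed about the
OPEN node U `SamePDropOfSkeletonFrmFrom₁` (nor U_s / the end state).  Lane `prim-bschramm`, seat `prim-hp-8 gen 53 (U-wave port pen, family P-hp8; tool of record = p3-g26 port_u.py)`; helper file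
(`--supports stmt-CriticalPhenomena-4575 --as helper`).  PORT RULES r1–r4 of RULING D-U: declaration order and proof texts are those of the original,
byte-identical except (i) the carrier token `PlanarSkeletonFrm ↦ PlanarSkeletonFrmFrom` (binders, `namespace`/`end` lines, qualified names of twinned
declarations), (ii) carrier-FREE declarations of the original (φ-level `Skelφ…` blocks and namespace-only arithmetic residents) are NOT re-declared —
this file imports the original and `export`s the twin-free residents (POLICY T / treatment (m1)); residents whose statement mentions a twinned
constant are copied, (iii) every carrier-binding declaration keeps its explicit binder `(Φ : PlanarSkeletonFrmFrom G)` in its own signature (r2).  Docstrings and citations are the original's.  Manifest row idx 160 (level 18; flags verbatim|DEF-ROW|RESIDENTS(T:1/free:0)); filed by the hp-8 lineage under RULING M-11 (family P-hp8).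
-/

noncomputable section

open scoped Classical

namespace Summit.CriticalPhenomena.PercolationContinuityZ3.Theorems.Transplant

namespace PlanarSkeletonFrmFrom

namespace NegB

open Literature.Probability.Percolation Literature.Probability.LatticeModels SimpleGraph
open SkelConc (Consts)
open Skelφ (kgSL)
open Neg

/-- **The (R) box residual** `gxR0 mk := 60·(Rs mk + 1)` ((R-46)(g): `M_L ≥ g ≥ 60(Rs+1)` ⇒ `sL ≥ 30·Rs + 28`). [this work] -/
def gxR0 (mk : ℕ) : Neg.FSlot := fun _ _ _ _ _ _ _ t _ D => 60 * (KS.Rs t D mk + 1)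

/-- **The (R) width residual** `fxR mk := KS.fxR0 mk = Rs + R′0 + prB0 + 1` (Bridge0). [this work] -/
def fxR (mk : ℕ) : Neg.FSlot := fun κ _ _ _ _ _ Φ t p D => KS.fxR0 κ Φ t p D mk

/-- **The (R) excess residual**: the max of the six excess floors of the two `_of_le` wrappers (see the module docstring). [this work] -/
def exR0 (mk : ℕ) : GSlot := fun κ _ _ _ _ _ Φ t p D g f =>
  max (KS0.r₀0 t D mk (RLD κ Φ t p D g f) + 1) (max (KS0.r₀0 t D mk (KS.RB0 κ Φ t p D mk) + 1) (max (KS.Yb0 κ Φ t p D mk g f + 1)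
    (max (KS.D0s κ Φ t p D mk g f (kgq κ Φ t p D g f (qxQ4 κ Φ t p D g f)) + ZD2 κ Φ t p D g f + 13 * (kgSL (nL κ Φ t p D g f) (ℓL κ Φ t p D g f) (hL κ Φ t p D g f)).toNat + 1)
    (max (KS.D0s κ Φ t p D mk g f (kgq κ Φ t p D g f 0) + KS.ZDP κ Φ t p D g f + 1)
      (KS.D2R κ Φ t p D mk g f (WxYQ4 κ Φ t p D g f) + ZDYW κ Φ t p D g f + 13 * nL κ Φ t p D g f + 1)))))

/-- **The (R) extra-pair slot** `PxR mk := KS.Px0 mk` (the root bridge pair; ChoiceBridge0's `hPx`). [this work] -/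
def PxR (mk : ℕ) : PSlot := KS.Px0 mk

/-- **The (R) rim-diameter residual** `mxR := 0` (the (R) rim device reads `mRS … mx` like (C): `hDm_R` holds at every `mx`). [this work] -/
def mxR : GSlot := fun _ _ _ _ _ _ _ _ _ _ _ _ => 0

section Floors

variable (κ : Consts) {V : Type} [DecidableEq V] [Countable V] {G : SimpleGraph V} [G.LocallyFinite] (Φ : PlanarSkeletonFrmFrom G) (t : V) (p : unitInterval)
  (D : Skelφ.StepI.DataNS V) (mk g f : ℕ)

/-- `gxR0` unfolded. [folklore] -/
theorem gxR0_at (κ : Consts) {V : Type} [DecidableEq V] [Countable V] {G : SimpleGraph V} [G.LocallyFinite] (Φ : PlanarSkeletonFrmFrom G) (t : V) (p : unitInterval) (D : Skelφ.StepI.DataNS V) (mk : ℕ) : gxR0 mk κ Φ t p D = 60 * (KS.Rs t D mk + 1) := rfl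

/-- `fxR` unfolded. [folklore] -/
theorem fxR_at (κ : Consts) {V : Type} [DecidableEq V] [Countable V] {G : SimpleGraph V} [G.LocallyFinite] (Φ : PlanarSkeletonFrmFrom G) (t : V) (p : unitInterval) (D : Skelφ.StepI.DataNS V) (mk : ℕ) : fxR mk κ Φ t p D = KS.fxR0 κ Φ t p D mk := rfl

/-- `PxR` unfolded. [folklore] -/
theorem PxR_at (κ : Consts) {V : Type} [DecidableEq V] [Countable V] {G : SimpleGraph V} [G.LocallyFinite] (Φ : PlanarSkeletonFrmFrom G) (t : V) (p : unitInterval) (D : Skelφ.StepI.DataNS V) (mk : ℕ) : PxR mk κ Φ t p D = KS.Px0 mk κ Φ t p D := rfl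

/-- `mxR = 0`. [folklore] -/
theorem mxR_at (κ : Consts) {V : Type} [DecidableEq V] [Countable V] {G : SimpleGraph V} [G.LocallyFinite] (Φ : PlanarSkeletonFrmFrom G) (t : V) (p : unitInterval) (D : Skelφ.StepI.DataNS V) (g : ℕ) (f : ℕ) : mxR κ Φ t p D g f = 0 := rfl

/-- **The six (R) excess floors from `exR0 mk ≤ ex`** (in the order `hexRL`, `hexRB`, `hexYb`, `hexZ`, `hexP`, `hexY`). [folklore] -/
theorem exR0_floors (κ : Consts) {V : Type} [DecidableEq V] [Countable V] {G : SimpleGraph V} [G.LocallyFinite] (Φ : PlanarSkeletonFrmFrom G) (t : V) (p : unitInterval) (D : Skelφ.StepI.DataNS V) (mk : ℕ) (g : ℕ) (f : ℕ) {ex : ℕ} (h : exR0 mk κ Φ t p D g f ≤ ex) :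
    KS0.r₀0 t D mk (RLD κ Φ t p D g f) + 1 ≤ ex ∧ KS0.r₀0 t D mk (KS.RB0 κ Φ t p D mk) + 1 ≤ ex ∧ KS.Yb0 κ Φ t p D mk g f + 1 ≤ ex ∧
    KS.D0s κ Φ t p D mk g f (kgq κ Φ t p D g f (qxQ4 κ Φ t p D g f)) + ZD2 κ Φ t p D g f +
        13 * (kgSL (nL κ Φ t p D g f) (ℓL κ Φ t p D g f) (hL κ Φ t p D g f)).toNat + 1 ≤ ex ∧
    KS.D0s κ Φ t p D mk g f (kgq κ Φ t p D g f 0) + KS.ZDP κ Φ t p D g f + 1 ≤ ex ∧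
    KS.D2R κ Φ t p D mk g f (WxYQ4 κ Φ t p D g f) + ZDYW κ Φ t p D g f + 13 * nL κ Φ t p D g f + 1 ≤ ex := by
  unfold exR0 at h
  simp only [max_le_iff] at h
  obtain ⟨h1, h2, h3, h4, h5, h6⟩ := h
  exact ⟨h1, h2, h3, h4, h5, h6⟩

/-- The six floors hold at `exR0` itself. [folklore] -/
theorem exR0_floors_self (κ : Consts) {V : Type} [DecidableEq V] [Countable V] {G : SimpleGraph V} [G.LocallyFinite] (Φ : PlanarSkeletonFrmFrom G) (t : V) (p : unitInterval) (D : Skelφ.StepI.DataNS V) (mk : ℕ) (g : ℕ) (f : ℕ) :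
    KS0.r₀0 t D mk (RLD κ Φ t p D g f) + 1 ≤ exR0 mk κ Φ t p D g f ∧ KS0.r₀0 t D mk (KS.RB0 κ Φ t p D mk) + 1 ≤ exR0 mk κ Φ t p D g f ∧
    KS.Yb0 κ Φ t p D mk g f + 1 ≤ exR0 mk κ Φ t p D g f ∧
    KS.D0s κ Φ t p D mk g f (kgq κ Φ t p D g f (qxQ4 κ Φ t p D g f)) + ZD2 κ Φ t p D g f +
        13 * (kgSL (nL κ Φ t p D g f) (ℓL κ Φ t p D g f) (hL κ Φ t p D g f)).toNat + 1 ≤ exR0 mk κ Φ t p D g f ∧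
    KS.D0s κ Φ t p D mk g f (kgq κ Φ t p D g f 0) + KS.ZDP κ Φ t p D g f + 1 ≤ exR0 mk κ Φ t p D g f ∧
    KS.D2R κ Φ t p D mk g f (WxYQ4 κ Φ t p D g f) + ZDYW κ Φ t p D g f + 13 * nL κ Φ t p D g f + 1 ≤ exR0 mk κ Φ t p D g f :=
  exR0_floors κ Φ t p D mk g f le_rfl

/-- **The box floor at any dominating slot**: `60·(Rs + 1) ≤ gx` from `gxR0 mk ≤ gx` (stmt's `le_gT_gxQ ….2.2`). [folklore] -/
theorem hgR_of_ge (κ : Consts) {V : Type} [DecidableEq V] [Countable V] {G : SimpleGraph V} [G.LocallyFinite] (Φ : PlanarSkeletonFrmFrom G) (t : V) (p : unitInterval) (D : Skelφ.StepI.DataNS V) (mk : ℕ) {gx : ℕ} (h : gxR0 mk κ Φ t p D ≤ gx) : 60 * (KS.Rs t D mk + 1) ≤ gx := h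

/-- **The width floor at any dominating slot**: `KS.fxR0 mk ≤ fx` from `fxR mk ≤ fx` (stmt's `le_fT_fxQ ….2.2`). [folklore] -/
theorem hf_of_ge (κ : Consts) {V : Type} [DecidableEq V] [Countable V] {G : SimpleGraph V} [G.LocallyFinite] (Φ : PlanarSkeletonFrmFrom G) (t : V) (p : unitInterval) (D : Skelφ.StepI.DataNS V) (mk : ℕ) {fx : ℕ} (h : fxR mk κ Φ t p D ≤ fx) : KS.fxR0 κ Φ t p D mk ≤ fx := h

end Floors

end NegB

end PlanarSkeletonFrmFrom

end Summit.CriticalPhenomena.PercolationContinuityZ3.Theorems.Transplant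

end
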